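import Literature.AlgebraicGeometry.Motives.GaloisDescentScheme
import Literature.AlgebraicGeometry.Motives.SymmetricPowerProjective
import Literature.AlgebraicGeometry.Motives.AbelianVarietyProjectiveChart
import Literature.AlgebraicGeometry.Motives.AbelianVarietyIsoOfScheme
import Literature.AlgebraicGeometry.Resolution.AlterationsDescentStage
import HarnessLib

/-!
# Galois descent of abelian varieties (Milne, *Jacobian Varieties*, 1.9; Weil)

Milne, *Jacobian Varieties*, Remark 1.9 / §4: "in constructing `J`, we are allowed to make a
finite separable extension of `k`" — the Jacobian constructed over a finite Galois extension
`L / k` descends to `k` because the functor it represents is defined over `k`, i.e. `Gal(L/k)`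
acts on `J_L` semilinearly and compatibly with the group law (Weil's descent; Görtz–Wedhorn I,
Thm. 14.83 / Cor. 14.85 for quasi-projective schemes, abelian varieties being projective). This
file proves that descent statement for abelian varieties in the vocabulary of the tree:

**`exists_iso_baseChange`.** Let `L / k` be finite Galois and `A` an abelian variety over `L`
(`Motives/AbelianVariety`) with an action `ρ` of `Gal(L/k)` on the scheme `A` over `Spec k`
covering `Spec σ⁻¹` on `Spec L` (`hρ`) and compatible with the multiplication, the unit and the
inversion (`hmul`, `hone`, `hinv`). Then there are an abelian variety `J` over `k` and an
isomorphism of abelian varieties `A ≅ J_L` over `L` carrying `ρ σ` to the Galois automorphism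
`1 × Spec σ⁻¹` of `J_L = J ×_k Spec L` (`AbelianVariety.gal`).

Steps (all proved here or in the imported bricks):

* `hcov` — every point of `A` lies in a `Gal`-stable affine open: `A` is projective over `L`
  (`AbelianVariety.isProjectiveOver_holds`), so finite sets of points lie in affine opens
  (`IsProjectiveOver.finiteSubsetsInAffineOpens`, graded prime avoidance), whence stable affine
  neighbourhoods (`GaloisDescentScheme.forall_exists_stableAffineOpen`);
* the `k`-form `Y₀ = A/Gal` and the equivariant `L`-isomorphism `A ≅ Y₀ ×_k Spec L`
  (`GaloisDescentScheme.descended`, `isoBaseChangeOver`, `aut_hom_isoBaseChange_hom`);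
* `Y₀ → Spec k` is proper (descent of properness along `Spec L → Spec k`,
  `isProper_of_isProper_baseChange`) and geometrically integral (`geometricallyIntegral_descended`:
  a base change of `Y₀` to a field `K ⊇ k` is dominated, flatly, by its base change to `K̄ ⊇ L`,
  which is a base change of `A`);
* the group law descends: `μ`, `η`, `ι` of `A`, transported to `Y₀ ×_k Spec L`, commute with the
  Galois automorphisms, hence are base changes of `k`-morphisms `m₀`, `e₀`, `i₀`
  (`GaloisDescent.descentOver`, Görtz–Wedhorn I, Thm. 14.72 (1)); these satisfy the group axioms
  because they do on `Ω`-points, `Ω = L̄`, where `Y₀(Ω)` embeds into the group `A(Ω)`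
  (`GrpObj.ofAlgPointsOfInjective`);
* `J = (Y₀, m₀, e₀, i₀)` and `A ≅ J_L` is an isomorphism of abelian varieties since it preserves
  the unit (rigidity, `AbelianVariety.isoOfOverIso`, Milne AV Cor. 2.2).

Everything is proved; no named facts (D-0026).

## References

* J. S. Milne, *Jacobian Varieties*, in *Arithmetic Geometry* (Storrs 1984), Springer 1986, §1,
  1.9 and §4 (first paragraph). [Milne1986JacobianVarieties]
* U. Görtz, T. Wedhorn, *Algebraic Geometry I: Schemes*, 2nd ed. (2020): §(14.20), Thm. 14.72 (1),
  Thm. 14.83, Cor. 14.85. [GortzWedhorn2020]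
* J. S. Milne, *Abelian Varieties*, in *Arithmetic Geometry* (1986), §2, Cor. 2.2. [Milne1986AbelianVarieties]
-/

noncomputable section

open CategoryTheory CategoryTheory.Limits AlgebraicGeometry MonoidalCategory CartesianMonoidalCategory
open Literature.AlgebraicGeometry.RelativeSpec

universe u

namespace Literature.AlgebraicGeometry.Motives

namespace GaloisDescentAbelianVariety

open AbelianVariety (bcSpec specAut bcFunctor specAut_comp_bcSpec bcFunctor_map_injective)
open scoped MonObj

set_option backward.isDefEq.respectTransparency false

variable {k : Type u} [Field k] (L : Type u) [Field L] [Algebra k L]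

/-! ### Preliminaries -/

/-- **Geometric integrality descends along a Galois base change.** In the situation of
`GaloisDescentScheme.isPullback_glued` (a cartesian square `X → Spec L`, `π : X → Y₀`, over
`Spec k`), if `X → Spec L` is geometrically integral then so is `Y₀ → Spec k`: for a field
`K ⊇ k` with algebraic closure `K̄` and a `k`-embedding `L → K̄`, the base change `Y₀ ×_k K̄` is a
base change of `X → Spec L`, hence integral, and it covers `Y₀ ×_k K` by a flat surjection.
[cite: GortzWedhorn2020, Thm. 14.83 (k-forms)] -/
theorem geometricallyIntegral_of_isPullback [Algebra.IsAlgebraic k L] {X Y₀ : Scheme.{u}}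
    (p : X ⟶ Spec (.of L)) (π : X ⟶ Y₀) (q : Y₀ ⟶ Spec (.of k))
    (H : IsPullback π p q (bcSpec k L)) [GeometricallyIntegral p] : GeometricallyIntegral q := by
  refine ⟨(geometrically_iff_of_commRing (f := q)).mpr fun K _ _ Y fst snd h ↦ ?_⟩
  -- `K̄` and a `k`-embedding `L → K̄`
  let Kb := AlgebraicClosure K
  let ψ : L →ₐ[k] Kb := IsAlgClosed.lift
  -- `Y' = Y ×_K K̄`, a base change of `Y₀` along `k → K̄`
  let g : Spec (.of Kb) ⟶ Spec (.of K) := Spec.map (CommRingCat.ofHom (algebraMap K Kb))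
  let Y' := pullback snd g
  have hbig : IsPullback (pullback.fst snd g ≫ fst) (pullback.snd snd g) q
      (Spec.map (CommRingCat.ofHom (algebraMap k Kb))) := by
    have e : Spec.map (CommRingCat.ofHom (algebraMap k Kb)) =
        g ≫ Spec.map (CommRingCat.ofHom (algebraMap k K)) := by
      rw [← Spec.map_comp, ← CommRingCat.ofHom_comp, ← IsScalarTower.algebraMap_eq]
    rw [e]
    exact (IsPullback.of_hasPullback snd g).paste_horiz h
  -- the same `k → K̄` factors through `L`
  have hfac : Spec.map (CommRingCat.ofHom (algebraMap k Kb)) =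
      Spec.map (CommRingCat.ofHom (ψ : L →+* Kb)) ≫ bcSpec k L := by
    rw [← Spec.map_comp]
    congr 1
    ext x
    change algebraMap k Kb x = ψ (algebraMap k L x)
    rw [AlgHom.commutes]
  -- lift `Y' → X` through the descent square and get a cartesian square over `Spec ψ`
  let t : Y' ⟶ X := H.lift (pullback.fst snd g ≫ fst)
    (pullback.snd snd g ≫ Spec.map (CommRingCat.ofHom (ψ : L →+* Kb)))
    (by have w := hbig.w; rw [hfac] at w; simpa only [Category.assoc] using w)
  have ht₁ : t ≫ π = pullback.fst snd g ≫ fst := H.lift_fst _ _ _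
  have ht₂ : t ≫ p = pullback.snd snd g ≫ Spec.map (CommRingCat.ofHom (ψ : L →+* Kb)) :=
    H.lift_snd _ _ _
  have hbig' : IsPullback (t ≫ π) (pullback.snd snd g) q
      (Spec.map (CommRingCat.ofHom (ψ : L →+* Kb)) ≫ bcSpec k L) := by
    rw [ht₁, ← hfac]; exact hbig
  have hleft : IsPullback t (pullback.snd snd g) p (Spec.map (CommRingCat.ofHom (ψ : L →+* Kb))) :=
    IsPullback.of_right hbig' ht₂ H
  haveI : IsIntegral Y' := GeometricallyIntegral.geometrically_isIntegral (f := p) _ _ _ hleft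
  -- descend integrality along the flat surjection `Y' → Y`
  haveI : Surjective g := (ProperDescent.fpqc_specMap K Kb).1.1
  haveI : Flat g := (ProperDescent.fpqc_specMap K Kb).1.2
  haveI : Surjective (pullback.fst snd g) := MorphismProperty.pullback_fst _ _ inferInstance
  haveI : Flat (pullback.fst snd g) := MorphismProperty.pullback_fst _ _ inferInstance
  exact Resolution.DeJong1996.Stage.isIntegral_of_flat_surjective (pullback.fst snd g)

variable (A : AbelianVariety L) (ρ : ActionOver (A.X.hom ≫ bcSpec k L) (L ≃ₐ[k] L))
  (hρ : ∀ σ : L ≃ₐ[k] L, (ρ.aut σ).hom ≫ A.X.hom = A.X.hom ≫ specAut L σ⁻¹)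

/-- **Every point of an abelian variety with a Galois action lies in a stable affine open**
(abelian varieties are projective, `AbelianVariety.isProjectiveOver_holds`; finite sets of points
of projective schemes lie in affine opens; intersect over the orbit). [cite: Milne1986JacobianVarieties, §1, 1.9 and §3, proof of Prop. 3.2] -/
theorem forall_exists_stableAffineOpen [FiniteDimensional k L] :
    ∀ x : A.X.left, ∃ O : ρ.StableAffineOpens, x ∈ O.1 := by
  haveI : IsSeparated A.X.hom := inferInstance
  -- separated over the separated `Spec L` (cf. `Scheme.isSeparated_of_isSeparated_over` of
  -- `Resolution/QuasiExcellentSchemes`, not imported here)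
  haveI : A.X.left.IsSeparated := ⟨by rw [← terminal.comp_from A.X.hom]; infer_instance⟩
  refine GaloisDescentScheme.forall_exists_stableAffineOpen ρ fun S ↦ ?_
  obtain ⟨W, hW, hS⟩ :=
    (IsProjectiveOver.finiteSubsetsInAffineOpens (AbelianVariety.isProjectiveOver_holds A)).exists_open S
  haveI := hW
  have hWa : IsAffine (W : Scheme.{u}) := isAffine_of_isAffineHom (W.ι ≫ A.X.hom)
  exact ⟨W, hWa, fun x hx ↦ hS x hx⟩

variable [FiniteDimensional k L] [IsGalois k L]

/-! ### The `k`-form `Y₀ = A/Gal` and `A ≅ Y₀ ×_k Spec L` -/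

/-- **The `k`-form `Y₀ = A/Gal(L/k) → Spec k`** of the abelian variety `A / L` with its semilinear
Galois action. [cite: Milne1986JacobianVarieties, §1, 1.9] -/
def form : SchemeOver k := GaloisDescentScheme.descended L ρ

include hρ in
/-- **`A ≅ Y₀ ×_k Spec L` over `L`.** [cite: GortzWedhorn2020, Thm. 14.83 and Cor. 14.85] -/
def isoBC : A.X ≅ (bcFunctor k L).obj (form L A ρ) :=
  GaloisDescentScheme.isoBaseChangeOver L A.X.hom ρ rfl hρ (forall_exists_stableAffineOpen L A ρ)

/-- The isomorphism is Galois-equivariant: `ρ σ ≫ e = e ≫ (1 × Spec σ⁻¹)`. [cite: GortzWedhorn2020, §(14.20) and Thm. 14.83] -/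
@[reassoc]
theorem aut_hom_isoBC_hom_left (σ : L ≃ₐ[k] L) :
    (ρ.aut σ).hom ≫ (isoBC L A ρ hρ).hom.left =
      (isoBC L A ρ hρ).hom.left ≫ GaloisDescent.gal L (form L A ρ) σ :=
  GaloisDescentScheme.aut_hom_isoBaseChange_hom L A.X.hom ρ rfl hρ _ σ

/-- Equivariance for the inverse: `(1 × Spec σ⁻¹) ≫ e⁻¹ = e⁻¹ ≫ ρ σ`. [folklore] -/
@[reassoc]
theorem gal_isoBC_inv_left (σ : L ≃ₐ[k] L) :
    GaloisDescent.gal L (form L A ρ) σ ≫ (isoBC L A ρ hρ).inv.left =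
      (isoBC L A ρ hρ).inv.left ≫ (ρ.aut σ).hom := by
  have h1 : (isoBC L A ρ hρ).hom.left ≫ (isoBC L A ρ hρ).inv.left = 𝟙 _ := by
    rw [← Over.comp_left, Iso.hom_inv_id, Over.id_left]
  have h2 : (isoBC L A ρ hρ).inv.left ≫ (isoBC L A ρ hρ).hom.left = 𝟙 _ := by
    rw [← Over.comp_left, Iso.inv_hom_id, Over.id_left]
  haveI : IsIso (isoBC L A ρ hρ).hom.left := inferInstance
  rw [← cancel_epi (isoBC L A ρ hρ).hom.left, reassoc_of% h1,
    ← aut_hom_isoBC_hom_left_assoc, h1, Category.comp_id]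

/-! ### `Y₀ → Spec k` is proper and geometrically integral -/

include hρ in
/-- **`Y₀ → Spec k` is proper** (descent of properness along `Spec L → Spec k`,
`isProper_of_isProper_baseChange`; `Y₀ ×_k L ≅ A` is proper over `L`). [cite: GortzWedhorn2020, Prop. 14.53 (5) with Example 14.55] -/
theorem isProper_form : IsProper (form L A ρ).hom := by
  refine isProper_of_isProper_baseChange (form L A ρ) L ?_
  change IsProper ((bcFunctor k L).obj (form L A ρ)).hom
  rw [← Over.w (isoBC L A ρ hρ).inv]
  infer_instance

include hρ in
/-- **`Y₀ → Spec k` is geometrically integral** (`geometricallyIntegral_of_isPullback` for the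
descent square of `A`). [cite: GortzWedhorn2020, Thm. 14.83] -/
theorem geometricallyIntegral_form : GeometricallyIntegral (form L A ρ).hom :=
  geometricallyIntegral_of_isPullback L A.X.hom _ _
    (GaloisDescentScheme.isPullback_glued L A.X.hom ρ rfl hρ (forall_exists_stableAffineOpen L A ρ))

/-! ### Reducedness of the base changes (hypotheses of Galois descent of morphisms) -/

include hρ in
/-- `Y₀ ×_k Spec L ≅ A` is reduced. [folklore] -/
theorem isReduced_bc_form : IsReduced (GaloisDescent.bc L (form L A ρ)) := by
  haveI : IsIntegral A.X.left := SchemeOver.isIntegral_left A.X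
  haveI : IsIso (isoBC L A ρ hρ).inv.left := inferInstance
  exact isReduced_of_isOpenImmersion (isoBC L A ρ hρ).inv.left

include hρ in
/-- `(Y₀ × Y₀) ×_k Spec L ≅ A × A` is reduced. [folklore] -/
theorem isReduced_bc_form_tensor : IsReduced (GaloisDescent.bc L (form L A ρ ⊗ form L A ρ)) := by
  haveI : IsReduced (A.X ⊗ A.X).left := SchemeOver.isReduced_left (A.X ⊗ A.X)
  let e : (bcFunctor k L).obj (form L A ρ ⊗ form L A ρ) ≅ A.X ⊗ A.X :=
    (Functor.Monoidal.μIso (bcFunctor k L) (form L A ρ) (form L A ρ)).symm ≪≫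
      ((isoBC L A ρ hρ).symm ⊗ᵢ (isoBC L A ρ hρ).symm)
  haveI : IsIso e.hom.left := inferInstance
  exact isReduced_of_isOpenImmersion e.hom.left

omit [FiniteDimensional k L] [IsGalois k L] in
/-- `(Spec k) ×_k Spec L ≅ Spec L` is reduced. [folklore] -/
theorem isReduced_bc_tensorUnit : IsReduced (GaloisDescent.bc L (𝟙_ (SchemeOver k))) := by
  let e : (bcFunctor k L).obj (𝟙_ (SchemeOver k)) ≅ 𝟙_ (SchemeOver L) :=
    (Functor.Monoidal.εIso (bcFunctor k L)).symm
  haveI : IsReduced (𝟙_ (SchemeOver L)).left := inferInstanceAs (IsReduced (Spec (.of L)))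
  haveI : IsIso e.hom.left := inferInstance
  exact isReduced_of_isOpenImmersion e.hom.left

omit [FiniteDimensional k L] [IsGalois k L] in
/-- `Spec k → Spec k` (the structure map of `𝟙_`) is locally of finite type. [folklore] -/
theorem locallyOfFiniteType_tensorUnit_hom (k : Type u) [Field k] :
    LocallyOfFiniteType (𝟙_ (SchemeOver k)).hom := by
  change LocallyOfFiniteType (𝟙 (Spec (.of k)))
  exact MorphismProperty.id_mem _ _

/-! ### Descending the group law -/

/-- The product action `ρ σ × ρ σ` on `A ×_L A` (over `Spec σ⁻¹`). [folklore] -/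
def aut₂ (σ : L ≃ₐ[k] L) : (A.X ⊗ A.X).left ⟶ (A.X ⊗ A.X).left :=
  pullback.map A.X.hom A.X.hom A.X.hom A.X.hom (ρ.aut σ).hom (ρ.aut σ).hom (specAut L σ⁻¹)
    (hρ σ).symm (hρ σ).symm

omit [FiniteDimensional k L] [IsGalois k L] in
/-- `(ρ σ × ρ σ) ≫ pr₁ = pr₁ ≫ ρ σ`. [folklore] -/
@[reassoc (attr := simp)]
theorem aut₂_fst (σ : L ≃ₐ[k] L) :
    aut₂ L A ρ hρ σ ≫ (fst A.X A.X).left = (fst A.X A.X).left ≫ (ρ.aut σ).hom := by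
  rw [Over.fst_left]; exact pullback.lift_fst _ _ _

omit [FiniteDimensional k L] [IsGalois k L] in
/-- `(ρ σ × ρ σ) ≫ pr₂ = pr₂ ≫ ρ σ`. [folklore] -/
@[reassoc (attr := simp)]
theorem aut₂_snd (σ : L ≃ₐ[k] L) :
    aut₂ L A ρ hρ σ ≫ (snd A.X A.X).left = (snd A.X A.X).left ≫ (ρ.aut σ).hom := by
  rw [Over.snd_left]; exact pullback.lift_snd _ _ _

/-- The base change `(Y₀)_L = Y₀ ×_k Spec L` as an `L`-scheme. [folklore] -/
abbrev formL : SchemeOver L := (bcFunctor k L).obj (form L A ρ)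

/-- The product Galois automorphism `gal σ × gal σ` of `(Y₀)_L × (Y₀)_L` (over `Spec σ⁻¹`). [folklore] -/
def gal₂ (σ : L ≃ₐ[k] L) : (formL L A ρ ⊗ formL L A ρ).left ⟶ (formL L A ρ ⊗ formL L A ρ).left :=
  pullback.map _ _ _ _ (GaloisDescent.gal L (form L A ρ) σ) (GaloisDescent.gal L (form L A ρ) σ)
    (specAut L σ⁻¹) (GaloisDescent.gal_snd L (form L A ρ) σ).symm
    (GaloisDescent.gal_snd L (form L A ρ) σ).symm

omit [IsGalois k L] in
/-- `(gal σ × gal σ) ≫ pr₁ = pr₁ ≫ gal σ`. [folklore] -/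
@[reassoc (attr := simp)]
theorem gal₂_fst (σ : L ≃ₐ[k] L) :
    gal₂ L A ρ σ ≫ (fst (formL L A ρ) (formL L A ρ)).left =
      (fst (formL L A ρ) (formL L A ρ)).left ≫ GaloisDescent.gal L (form L A ρ) σ := by
  rw [Over.fst_left]; exact pullback.lift_fst _ _ _

omit [IsGalois k L] in
/-- `(gal σ × gal σ) ≫ pr₂ = pr₂ ≫ gal σ`. [folklore] -/
@[reassoc (attr := simp)]
theorem gal₂_snd (σ : L ≃ₐ[k] L) :
    gal₂ L A ρ σ ≫ (snd (formL L A ρ) (formL L A ρ)).left =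
      (snd (formL L A ρ) (formL L A ρ)).left ≫ GaloisDescent.gal L (form L A ρ) σ := by
  rw [Over.snd_left]; exact pullback.lift_snd _ _ _

omit [IsGalois k L] in
/-- The Galois automorphism of `(Y₀ × Y₀)_L` is carried to `gal σ × gal σ` by the monoidal
structure isomorphism `δ : (Y₀ × Y₀)_L ⥲ (Y₀)_L × (Y₀)_L`. [folklore] -/
@[reassoc]
theorem gal_comp_δ_left (σ : L ≃ₐ[k] L) :
    GaloisDescent.gal L (form L A ρ ⊗ form L A ρ) σ ≫
        (Functor.OplaxMonoidal.δ (bcFunctor k L) (form L A ρ) (form L A ρ)).left =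
      (Functor.OplaxMonoidal.δ (bcFunctor k L) (form L A ρ) (form L A ρ)).left ≫ gal₂ L A ρ σ := by
  apply Over.tensorObj_ext
  · rw [Category.assoc, Category.assoc, ← Over.fst_left, gal₂_fst, ← Over.comp_left,
      Functor.OplaxMonoidal.δ_fst, ← Over.comp_left_assoc, Functor.OplaxMonoidal.δ_fst,
      GaloisDescent.gal_comp_map_left]
  · rw [Category.assoc, Category.assoc, ← Over.snd_left, gal₂_snd, ← Over.comp_left,
      Functor.OplaxMonoidal.δ_snd, ← Over.comp_left_assoc, Functor.OplaxMonoidal.δ_snd,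
      GaloisDescent.gal_comp_map_left]

/-- `gal σ × gal σ` is carried to `ρ σ × ρ σ` by `e⁻¹ × e⁻¹`. [folklore] -/
@[reassoc]
theorem gal₂_comp_tensor_inv_left (σ : L ≃ₐ[k] L) :
    gal₂ L A ρ σ ≫ ((isoBC L A ρ hρ).inv ⊗ₘ (isoBC L A ρ hρ).inv).left =
      ((isoBC L A ρ hρ).inv ⊗ₘ (isoBC L A ρ hρ).inv).left ≫ aut₂ L A ρ hρ σ := by
  apply Over.tensorObj_ext
  · rw [Category.assoc, Category.assoc, ← Over.fst_left, aut₂_fst, ← Over.comp_left,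
      tensorHom_fst, Over.comp_left, ← Over.comp_left_assoc, tensorHom_fst, Over.comp_left,
      Category.assoc, gal₂_fst_assoc, gal_isoBC_inv_left]
  · rw [Category.assoc, Category.assoc, ← Over.snd_left, aut₂_snd, ← Over.comp_left,
      tensorHom_snd, Over.comp_left, ← Over.comp_left_assoc, tensorHom_snd, Over.comp_left,
      Category.assoc, gal₂_snd_assoc, gal_isoBC_inv_left]

variable (hmul : ∀ σ : L ≃ₐ[k] L, aut₂ L A ρ hρ σ ≫ μ[A.X].left = μ[A.X].left ≫ (ρ.aut σ).hom)
  (hone : ∀ σ : L ≃ₐ[k] L, η[A.X].left ≫ (ρ.aut σ).hom = specAut L σ⁻¹ ≫ η[A.X].left)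
  (hinv : ∀ σ : L ≃ₐ[k] L, ι[A.X].left ≫ (ρ.aut σ).hom = (ρ.aut σ).hom ≫ ι[A.X].left)

/-- The multiplication of `A` transported to `(Y₀ × Y₀)_L → (Y₀)_L`. [folklore] -/
def mulL : (bcFunctor k L).obj (form L A ρ ⊗ form L A ρ) ⟶ (bcFunctor k L).obj (form L A ρ) :=
  Functor.OplaxMonoidal.δ (bcFunctor k L) (form L A ρ) (form L A ρ) ≫
    ((isoBC L A ρ hρ).inv ⊗ₘ (isoBC L A ρ hρ).inv) ≫ μ[A.X] ≫ (isoBC L A ρ hρ).hom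

include hmul in
/-- The transported multiplication commutes with the Galois automorphisms. [cite: Milne1986JacobianVarieties, §1, 1.9] -/
theorem gal_comp_mulL_left (σ : L ≃ₐ[k] L) :
    GaloisDescent.gal L (form L A ρ ⊗ form L A ρ) σ ≫ (mulL L A ρ hρ).left =
      (mulL L A ρ hρ).left ≫ GaloisDescent.gal L (form L A ρ) σ := by
  simp only [mulL, Over.comp_left, Category.assoc]
  rw [gal_comp_δ_left_assoc, gal₂_comp_tensor_inv_left_assoc, reassoc_of% (hmul σ),
    aut_hom_isoBC_hom_left]

/-- **The descended multiplication `m₀ : Y₀ × Y₀ → Y₀`** (Galois descent of the equivariant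
`L`-morphism `mulL`, Görtz–Wedhorn I, Thm. 14.72 (1)). [cite: GortzWedhorn2020, Thm. 14.72 (1)] -/
def mul₀ : form L A ρ ⊗ form L A ρ ⟶ form L A ρ :=
  haveI := isReduced_bc_form_tensor L A ρ hρ
  haveI := isProper_form L A ρ hρ
  GaloisDescent.descentOver L (mulL L A ρ hρ) (gal_comp_mulL_left L A ρ hρ hmul)

/-- `(m₀)_L = mulL`. [cite: GortzWedhorn2020, Thm. 14.72 (1)] -/
theorem bcFunctor_map_mul₀ : (bcFunctor k L).map (mul₀ L A ρ hρ hmul) = mulL L A ρ hρ := by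
  haveI := isReduced_bc_form_tensor L A ρ hρ
  haveI := isProper_form L A ρ hρ
  unfold mul₀
  exact GaloisDescent.bcFunctor_map_descentOver L (mulL L A ρ hρ) (gal_comp_mulL_left L A ρ hρ hmul)

/-- The unit of `A` transported to `(Spec k)_L → (Y₀)_L`. [folklore] -/
def oneL : (bcFunctor k L).obj (𝟙_ (SchemeOver k)) ⟶ (bcFunctor k L).obj (form L A ρ) :=
  Functor.OplaxMonoidal.η (bcFunctor k L) ≫ η[A.X] ≫ (isoBC L A ρ hρ).hom

omit [FiniteDimensional k L] [IsGalois k L] in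
/-- The underlying map of `η_F : (Spec k)_L → Spec L` is the structure map (second projection). [folklore] -/
theorem η_left : (Functor.OplaxMonoidal.η (bcFunctor k L)).left =
    ((bcFunctor k L).obj (𝟙_ (SchemeOver k))).hom := by
  conv_rhs => rw [← Over.w (Functor.OplaxMonoidal.η (bcFunctor k L))]
  exact (Category.comp_id _).symm

include hone in
/-- The transported unit commutes with the Galois automorphisms. [cite: Milne1986JacobianVarieties, §1, 1.9] -/
theorem gal_comp_oneL_left (σ : L ≃ₐ[k] L) :
    GaloisDescent.gal L (𝟙_ (SchemeOver k)) σ ≫ (oneL L A ρ hρ).left =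
      (oneL L A ρ hρ).left ≫ GaloisDescent.gal L (form L A ρ) σ := by
  simp only [oneL, Over.comp_left, Category.assoc]
  rw [η_left, AbelianVariety.bcFunctor_obj_hom, GaloisDescent.gal_snd_assoc, ← reassoc_of% (hone σ),
    aut_hom_isoBC_hom_left]

/-- **The descended unit `e₀ : Spec k → Y₀`.** [cite: GortzWedhorn2020, Thm. 14.72 (1)] -/
def one₀ : 𝟙_ (SchemeOver k) ⟶ form L A ρ :=
  haveI := isReduced_bc_tensorUnit (k := k) L
  haveI := isProper_form L A ρ hρ
  haveI : LocallyOfFiniteType (𝟙_ (SchemeOver k)).hom := locallyOfFiniteType_tensorUnit_hom k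
  GaloisDescent.descentOver L (oneL L A ρ hρ) (gal_comp_oneL_left L A ρ hρ hone)

/-- `(e₀)_L = oneL`. [cite: GortzWedhorn2020, Thm. 14.72 (1)] -/
theorem bcFunctor_map_one₀ : (bcFunctor k L).map (one₀ L A ρ hρ hone) = oneL L A ρ hρ := by
  haveI := isReduced_bc_tensorUnit (k := k) L
  haveI := isProper_form L A ρ hρ
  haveI : LocallyOfFiniteType (𝟙_ (SchemeOver k)).hom := locallyOfFiniteType_tensorUnit_hom k
  unfold one₀
  exact GaloisDescent.bcFunctor_map_descentOver L (oneL L A ρ hρ) (gal_comp_oneL_left L A ρ hρ hone)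

/-- The inversion of `A` transported to `(Y₀)_L → (Y₀)_L`. [folklore] -/
def invL : (bcFunctor k L).obj (form L A ρ) ⟶ (bcFunctor k L).obj (form L A ρ) :=
  (isoBC L A ρ hρ).inv ≫ ι[A.X] ≫ (isoBC L A ρ hρ).hom

include hinv in
/-- The transported inversion commutes with the Galois automorphisms. [cite: Milne1986JacobianVarieties, §1, 1.9] -/
theorem gal_comp_invL_left (σ : L ≃ₐ[k] L) :
    GaloisDescent.gal L (form L A ρ) σ ≫ (invL L A ρ hρ).left =
      (invL L A ρ hρ).left ≫ GaloisDescent.gal L (form L A ρ) σ := by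
  simp only [invL, Over.comp_left, Category.assoc]
  rw [gal_isoBC_inv_left_assoc, ← reassoc_of% (hinv σ), aut_hom_isoBC_hom_left]

/-- **The descended inversion `i₀ : Y₀ → Y₀`.** [cite: GortzWedhorn2020, Thm. 14.72 (1)] -/
def inv₀ : form L A ρ ⟶ form L A ρ :=
  haveI := isReduced_bc_form L A ρ hρ
  haveI := isProper_form L A ρ hρ
  GaloisDescent.descentOver L (invL L A ρ hρ) (gal_comp_invL_left L A ρ hρ hinv)

/-- `(i₀)_L = invL`. [cite: GortzWedhorn2020, Thm. 14.72 (1)] -/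
theorem bcFunctor_map_inv₀ : (bcFunctor k L).map (inv₀ L A ρ hρ hinv) = invL L A ρ hρ := by
  haveI := isReduced_bc_form L A ρ hρ
  haveI := isProper_form L A ρ hρ
  unfold inv₀
  exact GaloisDescent.bcFunctor_map_descentOver L (invL L A ρ hρ) (gal_comp_invL_left L A ρ hρ hinv)

/-! ### The group axioms, checked on `L̄`-points inside the group `A(L̄)` -/

section Points

variable (Ω : Type u) [Field Ω] [Algebra k Ω] [Algebra L Ω] [IsScalarTower k L Ω]

omit [FiniteDimensional k L] [IsGalois k L] in
/-- The canonical `L`-point of `(Spec Ω)_L = Spec Ω ×_k Spec L` given by `L → Ω`: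
`(1, Spec(L → Ω))`. [folklore] -/
def specPoint : specOver L Ω ⟶ (bcFunctor k L).obj (specOver k Ω) :=
  Over.homMk (pullback.lift (𝟙 _) (Spec.map (CommRingCat.ofHom (algebraMap L Ω))) (by
    rw [Category.id_comp]
    change Spec.map (CommRingCat.ofHom (algebraMap k Ω)) = _ ≫ Spec.map _
    rw [← Spec.map_comp, ← CommRingCat.ofHom_comp, ← IsScalarTower.algebraMap_eq]))
    (pullback.lift_snd _ _ _)

omit [FiniteDimensional k L] [IsGalois k L] in
/-- `specPoint ≫ pr₁ = 𝟙`. [folklore] -/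
@[reassoc (attr := simp)]
theorem specPoint_left_fst :
    (specPoint (k := k) L Ω).left ≫ pullback.fst _ _ = 𝟙 _ :=
  pullback.lift_fst _ _ _

/-- **`Y₀(Ω) ↪ A(Ω)`**: a `k`-point `P` of `Y₀` gives the `L`-point `e⁻¹ ∘ P_L ∘ (1, Spec(L → Ω))`
of `A`. [folklore] -/
def pointMap (P : AlgPoints (form L A ρ) Ω) : AlgPoints A.X Ω :=
  specPoint L Ω ≫ (bcFunctor k L).map P ≫ (isoBC L A ρ hρ).inv

/-- `pointMap` is injective (the first projection recovers `P`). [folklore] -/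
theorem pointMap_injective : Function.Injective (pointMap L A ρ hρ Ω) := by
  intro P Q h
  have h' : specPoint L Ω ≫ (bcFunctor k L).map P = specPoint L Ω ≫ (bcFunctor k L).map Q := by
    have := congrArg (· ≫ (isoBC L A ρ hρ).hom) h
    simp only [pointMap, Category.assoc] at this
    rwa [Iso.inv_hom_id, Category.comp_id, Category.comp_id] at this
  have h'' := congrArg (fun f ↦ f.left ≫ pullback.fst _ _) h'
  simp only [Over.comp_left, Category.assoc, Over.pullback_map_left, pullback.lift_fst,
    specPoint_left_fst_assoc] at h''
  exact Over.OverMorphism.ext h''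

/-- `pointMap` carries `(P, Q) ↦ ⟨P, Q⟩ ≫ m₀` to the product in `A(Ω)`. [folklore] -/
theorem pointMap_mul (P Q : AlgPoints (form L A ρ) Ω) :
    pointMap L A ρ hρ Ω (lift P Q ≫ mul₀ L A ρ hρ hmul) =
      pointMap L A ρ hρ Ω P * pointMap L A ρ hρ Ω Q := by
  rw [pointMap, Functor.map_comp, bcFunctor_map_mul₀, mulL]
  simp only [Category.assoc, Iso.hom_inv_id, Category.comp_id]
  rw [Functor.OplaxMonoidal.lift_δ_assoc, comp_lift_assoc, lift_map_assoc, CategoryTheory.Hom.mul_def,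
    pointMap, pointMap]
  simp only [Category.assoc]

/-- `pointMap` carries `e₀` to `1 ∈ A(Ω)`. [folklore] -/
theorem pointMap_one :
    pointMap L A ρ hρ Ω (toUnit _ ≫ one₀ L A ρ hρ hone) = 1 := by
  rw [pointMap, Functor.map_comp, bcFunctor_map_one₀, oneL]
  simp only [Category.assoc, Iso.hom_inv_id, Category.comp_id]
  rw [CategoryTheory.Hom.one_def, ← Category.assoc, ← Category.assoc]
  congr 1
  exact toUnit_unique _ _

/-- `pointMap` carries `P ↦ P ≫ i₀` to inversion in `A(Ω)`. [folklore] -/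
theorem pointMap_inv (P : AlgPoints (form L A ρ) Ω) :
    pointMap L A ρ hρ Ω (P ≫ inv₀ L A ρ hρ hinv) = (pointMap L A ρ hρ Ω P)⁻¹ := by
  rw [pointMap, Functor.map_comp, bcFunctor_map_inv₀, invL]
  simp only [Category.assoc, Iso.hom_inv_id, Category.comp_id]
  rw [CategoryTheory.Hom.inv_def, pointMap]
  simp only [Category.assoc]

end Points

/-! ### The descended abelian variety -/

/-- **The group-scheme structure on `Y₀`** with structure maps `m₀, e₀, i₀`: the axioms hold
because they hold on `L̄`-points, `Y₀(L̄) ↪ A(L̄)` being compatible with all three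
(`GrpObj.ofAlgPointsOfInjective`). [cite: Milne1986JacobianVarieties, §1, 1.9] -/
@[implicit_reducible]
def grpObj : GrpObj (form L A ρ) :=
  haveI := isProper_form L A ρ hρ
  haveI := geometricallyIntegral_form L A ρ hρ
  GrpObj.ofAlgPointsOfInjective (Ω := AlgebraicClosure L)
    (mul := mul₀ L A ρ hρ hmul) (one := one₀ L A ρ hρ hone) (inv := inv₀ L A ρ hρ hinv)
    (fun P ↦ Additive.ofMul (pointMap L A ρ hρ (AlgebraicClosure L) P))
    (Additive.ofMul.injective.comp (pointMap_injective L A ρ hρ _))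
    (fun P Q ↦ by rw [← ofMul_mul, pointMap_mul])
    (by rw [← ofMul_one, pointMap_one])
    (fun P ↦ by rw [← ofMul_inv, pointMap_inv])

/-- **The descended abelian variety `J / k`** (`Y₀` with the descended group law; proper and
geometrically integral). [cite: Milne1986JacobianVarieties, §1, 1.9] -/
def descent : AbelianVariety k where
  X := form L A ρ
  grpObj := grpObj L A ρ hρ hmul hone hinv
  isProper := isProper_form L A ρ hρ
  geometricallyIntegral := geometricallyIntegral_form L A ρ hρ

/-- The underlying `k`-scheme of the descended abelian variety is `Y₀ = A/Gal` (by `rfl`). [folklore] -/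
theorem descent_X : (descent L A ρ hρ hmul hone hinv).X = form L A ρ := rfl

/-- **`A ≅ J_L` preserves the unit**, hence is an isomorphism of abelian varieties. [folklore] -/
theorem one_comp_isoBC_hom :
    η[A.X] ≫ (isoBC L A ρ hρ).hom = η[((descent L A ρ hρ hmul hone hinv).baseChange L).X] := by
  change η[A.X] ≫ (isoBC L A ρ hρ).hom =
    Functor.LaxMonoidal.ε (bcFunctor k L) ≫ (bcFunctor k L).map (one₀ L A ρ hρ hone)
  rw [bcFunctor_map_one₀, oneL, Functor.Monoidal.ε_η_assoc]

/-- **The isomorphism of abelian varieties `A ≅ J_L`** over `L` (rigidity: an isomorphism of the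
underlying `L`-schemes preserving the unit is a homomorphism, `AbelianVariety.isoOfOverIso`).
[cite: Milne1986AbelianVarieties, §2 Cor. 2.2] [cite: Milne1986JacobianVarieties, §1, 1.9] -/
def descentIso : A ≅ (descent L A ρ hρ hmul hone hinv).baseChange L :=
  AbelianVariety.isoOfOverIso (B := A) (C := (descent L A ρ hρ hmul hone hinv).baseChange L)
    (isoBC L A ρ hρ) (one_comp_isoBC_hom L A ρ hρ hmul hone hinv)

/-- The underlying scheme morphism of `descentIso` is that of `isoBC` (by `rfl`). [folklore] -/
theorem descentIso_hom_toSchemeHom :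
    AbelianVariety.Hom.toSchemeHom (descentIso L A ρ hρ hmul hone hinv).hom =
      (isoBC L A ρ hρ).hom.left := rfl

/-- **Equivariance**: `A ≅ J_L` carries the given action `ρ σ` to the Galois automorphism
`1 × Spec σ⁻¹` of `J_L` (`AbelianVariety.gal`). [cite: GortzWedhorn2020, §(14.20) and Thm. 14.83] -/
theorem aut_hom_comp_descentIso (σ : L ≃ₐ[k] L) :
    (ρ.aut σ).hom ≫ AbelianVariety.Hom.toSchemeHom (descentIso L A ρ hρ hmul hone hinv).hom =
      AbelianVariety.Hom.toSchemeHom (descentIso L A ρ hρ hmul hone hinv).hom ≫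
        (descent L A ρ hρ hmul hone hinv).gal L σ :=
  aut_hom_isoBC_hom_left L A ρ hρ σ

include hρ hmul hone hinv in
/-- **Galois descent of abelian varieties** (Milne, *Jacobian Varieties*, 1.9; Weil): an abelian
variety `A` over a finite Galois extension `L / k` with a semilinear action of `Gal(L/k)`
compatible with its group law is the base change of an abelian variety `J` over `k`, by an
isomorphism carrying the action to the Galois automorphisms of `J_L`.
[cite: Milne1986JacobianVarieties, §1, 1.9] [cite: GortzWedhorn2020, Thm. 14.83 and Cor. 14.85] -/
theorem exists_iso_baseChange :
    ∃ (J : AbelianVariety k) (e : A ≅ J.baseChange L), ∀ σ : L ≃ₐ[k] L,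
      (ρ.aut σ).hom ≫ AbelianVariety.Hom.toSchemeHom e.hom =
        AbelianVariety.Hom.toSchemeHom e.hom ≫ J.gal L σ :=
  ⟨descent L A ρ hρ hmul hone hinv, descentIso L A ρ hρ hmul hone hinv,
    aut_hom_comp_descentIso L A ρ hρ hmul hone hinv⟩

end GaloisDescentAbelianVariety

end Literature.AlgebraicGeometry.Motives
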